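import Summits.RiemannHypothesis.RiemannHypothesis.Theorems.TiltedLandingLaw421R3Lens1ArcSignN

/-! # Lens1LinkTolNeg20Legal — IMAGE CANDIDATE v2 (C6 rh-idea-4 g47; W-08 ⟨33346⟩ `TiltedLandingLaw421R`, token «162L» if keyed)
LEGALITY of the 162 kernel row of record ((CA1156)(3)): row L1 = {±i, ±5/4 ± 22/25·i}, tilt 0,
`F z = (z²+1)(z⁴ − a z² + c)`, a = 7881/5000, c = 546110161/10⁸ (the same function as `RhW08.Lens1LinkTolNeg20Pre.F`, by `rfl`).
Main theorem: `engineHyps5_L1 : RhIdea6.G17.W07C7.Rev6.EngineHyps5 2 (1/2) F 0 (1/2) 1 40 1 100` — kernel books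
(C, η, x₀, s, hmax, R, Hs, B) = (2, 1/2, 0, 1/2, 1, 40, 1, 100); any legal tuple instantiates lens-1's ∀-frame laws, so this one
discharges the legality hypothesis of `not_topLinkLawTolQ_tenth_of_legal` (lens-1 162b).  Pattern of
`Theorems/TiltedLandingLaw421/Negative/AlphaSealDatum.lean` (`engineHyps5_D`) with one device: every constrained zero set of clauses
(12)/(13)/(16) is `Z.filter P` for the six-point `Z : Finset ℂ`, so the budgets are cardinalities ≤ 6 and the remainder of (16) is the sum
over the far zeros (`Finset.sum_sdiff`), each term ≤ 1/20 at near radius R/2 = 20.  ONE import (#1202).  No new mathematics about ξ;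
nothing here bears on the truth of RH. -/

namespace RhW08.Lens1LinkTolNeg20Legal

open Complex Set Filter RhIdea6.G17.W07C7 RhIdea6.G17.W07C7.Rev6
open scoped Classical

/-- the frame function of the row (tilt 0). -/
noncomputable def F (z : ℂ) : ℂ := (z ^ 2 + 1) * (z ^ 4 - (7881/5000 : ℂ) * z ^ 2 + (546110161/100000000 : ℂ))
/-- its derivative. -/
noncomputable def F1 (z : ℂ) : ℂ :=
  2 * z * (z ^ 4 - (7881/5000 : ℂ) * z ^ 2 + (546110161/100000000 : ℂ)) + (z ^ 2 + 1) * (4 * z ^ 3 - (7881/5000 : ℂ) * (2 * z))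

/-- the derivative of `F` is `F1` (product rule). -/
theorem hasDerivAt_F (z : ℂ) : HasDerivAt F (F1 z) z := by
  have h1 : HasDerivAt (fun x : ℂ => x ^ 2 + 1) (2 * z) z := by
    simpa using (hasDerivAt_pow 2 z).add_const (1 : ℂ)
  have h2 : HasDerivAt (fun x : ℂ => x ^ 4 - (7881/5000 : ℂ) * x ^ 2 + (546110161/100000000 : ℂ))
      (4 * z ^ 3 - (7881/5000 : ℂ) * (2 * z)) z := by
    simpa using ((hasDerivAt_pow 4 z).sub ((hasDerivAt_pow 2 z).const_mul (7881/5000 : ℂ))).add_const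
      (546110161/100000000 : ℂ)
  have h : HasDerivAt (fun x : ℂ => (x ^ 2 + 1) * (x ^ 4 - (7881/5000 : ℂ) * x ^ 2 + (546110161/100000000 : ℂ)))
      (2 * z * (z ^ 4 - (7881/5000 : ℂ) * z ^ 2 + (546110161/100000000 : ℂ)) +
        (z ^ 2 + 1) * (4 * z ^ 3 - (7881/5000 : ℂ) * (2 * z))) z := h1.mul h2
  exact h

/-- `deriv F = F1`. -/
theorem deriv_F : deriv F = F1 := funext fun z => (hasDerivAt_F z).deriv

/-- clause (1): `F` is entire. -/
theorem differentiable_F : Differentiable ℂ F := fun z => (hasDerivAt_F z).differentiableAt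

/-- real-pair factorisation (no `I`). -/
theorem F_factor_real (z : ℂ) :
    F z = (z ^ 2 + 1) * ((z - 5/4) ^ 2 + (22/25 : ℂ) ^ 2) * ((z + 5/4) ^ 2 + (22/25 : ℂ) ^ 2) := by
  unfold F; ring

/-- `w² + q² = (w − qi)(w + qi)`. -/
theorem sq_add_sq_eq (w q : ℂ) : w ^ 2 + q ^ 2 = (w - q * I) * (w + q * I) := by
  have h : (w - q * I) * (w + q * I) = w ^ 2 - q ^ 2 * I ^ 2 := by ring
  rw [h, I_sq]; ring

/-- full linear factorisation over ℂ. -/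
theorem F_factor (z : ℂ) :
    F z = (z - I) * (z + I) * ((z - 5/4 - 22/25 * I) * (z - 5/4 + 22/25 * I)) *
      ((z + 5/4 - 22/25 * I) * (z + 5/4 + 22/25 * I)) := by
  rw [F_factor_real, sq_add_sq_eq (z - 5/4), sq_add_sq_eq (z + 5/4)]
  have h1 : z ^ 2 + 1 = (z - I) * (z + I) := by simpa using sq_add_sq_eq z 1
  rw [h1]

/-- THE ZERO SET: `{±i, ±5/4 ± 22/25·i}`. -/
theorem F_eq_zero_iff (z : ℂ) : F z = 0 ↔
    z = I ∨ z = -I ∨ z = 5/4 + 22/25 * I ∨ z = 5/4 - 22/25 * I ∨ z = -5/4 + 22/25 * I ∨ z = -5/4 - 22/25 * I := by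
  rw [F_factor]
  simp only [mul_eq_zero]
  constructor
  · rintro (((h | h) | (h | h)) | (h | h))
    · exact Or.inl (by linear_combination h)
    · exact Or.inr (Or.inl (by linear_combination h))
    · exact Or.inr (Or.inr (Or.inl (by linear_combination h)))
    · exact Or.inr (Or.inr (Or.inr (Or.inl (by linear_combination h))))
    · exact Or.inr (Or.inr (Or.inr (Or.inr (Or.inl (by linear_combination h)))))
    · exact Or.inr (Or.inr (Or.inr (Or.inr (Or.inr (by linear_combination h)))))
  · rintro (h | h | h | h | h | h)
    · exact Or.inl (Or.inl (Or.inl (by rw [h]; ring)))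
    · exact Or.inl (Or.inl (Or.inr (by rw [h]; ring)))
    · exact Or.inl (Or.inr (Or.inl (by rw [h]; ring)))
    · exact Or.inl (Or.inr (Or.inr (by rw [h]; ring)))
    · exact Or.inr (Or.inl (by rw [h]; ring))
    · exact Or.inr (Or.inr (by rw [h]; ring))

/-- the six zeros as a `Finset`. -/
noncomputable def Z : Finset ℂ := {I, -I, 5/4 + 22/25 * I, 5/4 - 22/25 * I, -5/4 + 22/25 * I, -5/4 - 22/25 * I}

/-- `Z` is exactly the zero set. -/
theorem mem_Z (u : ℂ) : u ∈ Z ↔ F u = 0 := by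
  rw [F_eq_zero_iff]; simp only [Z, Finset.mem_insert, Finset.mem_singleton]

/-- `Z` has at most six points. -/
theorem card_Z_le : Z.card ≤ 6 := by
  unfold Z
  refine (Finset.card_insert_le _ _).trans ?_
  refine Nat.succ_le_succ ((Finset.card_insert_le _ _).trans ?_)
  refine Nat.succ_le_succ ((Finset.card_insert_le _ _).trans ?_)
  refine Nat.succ_le_succ ((Finset.card_insert_le _ _).trans ?_)
  refine Nat.succ_le_succ ((Finset.card_insert_le _ _).trans ?_)
  simp

/-- every constrained zero set of `F` is a filter of `Z`. -/
theorem zeroSet_eq (P : ℂ → Prop) : {u : ℂ | F u = 0 ∧ P u} = ↑(Z.filter P) := by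
  ext u
  simp only [Set.mem_setOf_eq, Finset.coe_filter, mem_Z]

/-- `F` is real on ℝ. -/
theorem F_real (x : ℝ) : (F (x : ℂ)).im = 0 := by
  unfold F
  rw [show (x : ℂ) ^ 2 + 1 = ((x ^ 2 + 1 : ℝ) : ℂ) by push_cast; ring,
    show (x : ℂ) ^ 4 - (7881/5000 : ℂ) * (x : ℂ) ^ 2 + (546110161/100000000 : ℂ)
      = ((x ^ 4 - 7881/5000 * x ^ 2 + 546110161/100000000 : ℝ) : ℂ) by push_cast; ring,
    ← ofReal_mul, ofReal_im]

/-- `T = i` is a zero (clause (11) witness). -/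
theorem F_I : F I = 0 := (F_eq_zero_iff I).2 (Or.inl rfl)

/-- zeros lie in `|Im| ≤ 1`. -/
theorem F_zero_im (w : ℂ) (hw : F w = 0) : |w.im| ≤ 1 := by
  rcases (F_eq_zero_iff w).1 hw with rfl | rfl | rfl | rfl | rfl | rfl <;> norm_num [abs_le]

/-! ## simple zeros: `analyticOrderAt F u = 1` on `Z` -/

/-- order one from a linear factorisation with non-vanishing cofactor. -/
theorem order_one_of_factor (u : ℂ) (g : ℂ → ℂ) (hg : Differentiable ℂ g) (hgu : g u ≠ 0)
    (hfac : ∀ z, F z = (z - u) * g z) : analyticOrderAt F u = (1 : ℕ) := by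
  rw [AnalyticAt.analyticOrderAt_eq_natCast (differentiable_F.analyticAt u)]
  refine ⟨g, hg.analyticAt u, hgu, Filter.Eventually.of_forall fun z => ?_⟩
  rw [hfac z, pow_one, smul_eq_mul]

/-- all six zeros are simple: `analyticOrderAt F u = 1` on `Z`. -/
theorem order_one (u : ℂ) (hu : u ∈ Z) : analyticOrderAt F u = (1 : ℕ) := by
  simp only [Z, Finset.mem_insert, Finset.mem_singleton] at hu
  rcases hu with rfl | rfl | rfl | rfl | rfl | rfl
  · refine order_one_of_factor _ (fun z => (z + I) * (z - 5/4 - 22/25 * I) * (z - 5/4 + 22/25 * I) * (z + 5/4 - 22/25 * I) * (z + 5/4 + 22/25 * I)) (by fun_prop) ?_ (fun z => by rw [F_factor]; ring)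
    refine mul_ne_zero (mul_ne_zero (mul_ne_zero (mul_ne_zero ?_ ?_) ?_) ?_) ?_ <;> norm_num [Complex.ext_iff]
  · refine order_one_of_factor _ (fun z => (z - I) * (z - 5/4 - 22/25 * I) * (z - 5/4 + 22/25 * I) * (z + 5/4 - 22/25 * I) * (z + 5/4 + 22/25 * I)) (by fun_prop) ?_ (fun z => by rw [F_factor]; ring)
    refine mul_ne_zero (mul_ne_zero (mul_ne_zero (mul_ne_zero ?_ ?_) ?_) ?_) ?_ <;> norm_num [Complex.ext_iff]
  · refine order_one_of_factor _ (fun z => (z - I) * (z + I) * (z - 5/4 + 22/25 * I) * (z + 5/4 - 22/25 * I) * (z + 5/4 + 22/25 * I)) (by fun_prop) ?_ (fun z => by rw [F_factor]; ring)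
    refine mul_ne_zero (mul_ne_zero (mul_ne_zero (mul_ne_zero ?_ ?_) ?_) ?_) ?_ <;> norm_num [Complex.ext_iff]
  · refine order_one_of_factor _ (fun z => (z - I) * (z + I) * (z - 5/4 - 22/25 * I) * (z + 5/4 - 22/25 * I) * (z + 5/4 + 22/25 * I)) (by fun_prop) ?_ (fun z => by rw [F_factor]; ring)
    refine mul_ne_zero (mul_ne_zero (mul_ne_zero (mul_ne_zero ?_ ?_) ?_) ?_) ?_ <;> norm_num [Complex.ext_iff]
  · refine order_one_of_factor _ (fun z => (z - I) * (z + I) * (z - 5/4 - 22/25 * I) * (z - 5/4 + 22/25 * I) * (z + 5/4 + 22/25 * I)) (by fun_prop) ?_ (fun z => by rw [F_factor]; ring)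
    refine mul_ne_zero (mul_ne_zero (mul_ne_zero (mul_ne_zero ?_ ?_) ?_) ?_) ?_ <;> norm_num [Complex.ext_iff]
  · refine order_one_of_factor _ (fun z => (z - I) * (z + I) * (z - 5/4 - 22/25 * I) * (z - 5/4 + 22/25 * I) * (z + 5/4 - 22/25 * I)) (by fun_prop) ?_ (fun z => by rw [F_factor]; ring)
    refine mul_ne_zero (mul_ne_zero (mul_ne_zero (mul_ne_zero ?_ ?_) ?_) ?_) ?_ <;> norm_num [Complex.ext_iff]

/-- `ℕ`-valued form of `order_one`. -/
theorem orderNat_one (u : ℂ) (hu : u ∈ Z) : (analyticOrderAt F u).toNat = 1 := by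
  rw [order_one u hu]; rfl

/-! ## zero-count sums: every constrained count is a cardinality ≤ 6 -/

/-- a constrained zero count of `F` is the cardinality of the corresponding filter of `Z`. -/
theorem finsum_zero_filter (P : ℂ → Prop) :
    (∑ᶠ u ∈ {u : ℂ | F u = 0 ∧ P u}, ((analyticOrderAt F u).toNat : ℝ)) = ((Z.filter P).card : ℝ) := by
  rw [zeroSet_eq P, finsum_mem_coe_finset, Finset.card_eq_sum_ones, Nat.cast_sum]
  refine Finset.sum_congr rfl fun u hu => ?_
  simp [orderNat_one u (Finset.mem_filter.1 hu).1]

/-- any filter of `Z` has at most six points. -/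
theorem card_filter_le6 (P : ℂ → Prop) : ((Z.filter P).card : ℝ) ≤ 6 := by
  exact_mod_cast (Finset.card_filter_le Z P).trans card_Z_le

/-- every constrained zero count lies in `[0, 6]`. -/
theorem finsum_zero_le6 (P : ℂ → Prop) :
    (∑ᶠ u ∈ {u : ℂ | F u = 0 ∧ P u}, ((analyticOrderAt F u).toNat : ℝ)) ≤ 6 ∧
      0 ≤ (∑ᶠ u ∈ {u : ℂ | F u = 0 ∧ P u}, ((analyticOrderAt F u).toNat : ℝ)) := by
  rw [finsum_zero_filter P]; exact ⟨card_filter_le6 P, by positivity⟩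

/-- (12) column budget with B = 100, s = 1/2, R = 40. -/
theorem column_L1 : ColumnBudgetMult 100 F 0 (1/2) 40 := by
  intro r hr _
  have h := finsum_zero_le6 (fun u => |u.re - 0| ≤ r)
  beta_reduce at h
  obtain ⟨h6, -⟩ := h
  have : 2 * r / (1/2 : ℝ) = 4 * r := by ring
  rw [this]; push_cast; linarith

/-- (13) half-slab budgets with B = 100. -/
theorem halfSlab_L1 : HalfSlabBudget 100 F 0 (1/2) 40 := by
  intro r hr hR
  have hA := finsum_zero_le6 (fun u => 0 < u.re ∧ u.re ≤ 0 + r)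
  have hB := finsum_zero_le6 (fun u => 0 - r ≤ u.re ∧ u.re < 0)
  beta_reduce at hA hB
  obtain ⟨hA6, hA0⟩ := hA
  obtain ⟨hB6, hB0⟩ := hB
  have : r / (1/2 : ℝ) = 2 * r := by ring
  rw [this]
  constructor <;> (rw [abs_le]; push_cast; constructor <;> linarith)

/-! ## the logarithmic derivative and the remainder -/

/-- a sum over `Z` is the explicit six-term sum (15 distinctness facts). -/
theorem sum_Z (g : ℂ → ℂ) : ∑ u ∈ Z, g u =
    g I + g (-I) + g (5/4 + 22/25 * I) + g (5/4 - 22/25 * I) + g (-5/4 + 22/25 * I) + g (-5/4 - 22/25 * I) := by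
  have h1 : I ∉ ({-I, 5/4 + 22/25 * I, 5/4 - 22/25 * I, -5/4 + 22/25 * I, -5/4 - 22/25 * I} : Finset ℂ) := by
    simp only [Finset.mem_insert, Finset.mem_singleton, not_or]
    refine ⟨?_, ?_, ?_, ?_, ?_⟩ <;> norm_num [Complex.ext_iff]
  have h2 : -I ∉ ({5/4 + 22/25 * I, 5/4 - 22/25 * I, -5/4 + 22/25 * I, -5/4 - 22/25 * I} : Finset ℂ) := by
    simp only [Finset.mem_insert, Finset.mem_singleton, not_or]
    refine ⟨?_, ?_, ?_, ?_⟩ <;> norm_num [Complex.ext_iff]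
  have h3 : (5/4 + 22/25 * I : ℂ) ∉ ({5/4 - 22/25 * I, -5/4 + 22/25 * I, -5/4 - 22/25 * I} : Finset ℂ) := by
    simp only [Finset.mem_insert, Finset.mem_singleton, not_or]
    refine ⟨?_, ?_, ?_⟩ <;> norm_num [Complex.ext_iff]
  have h4 : (5/4 - 22/25 * I : ℂ) ∉ ({-5/4 + 22/25 * I, -5/4 - 22/25 * I} : Finset ℂ) := by
    simp only [Finset.mem_insert, Finset.mem_singleton, not_or]
    refine ⟨?_, ?_⟩ <;> norm_num [Complex.ext_iff]
  have h5 : (-5/4 + 22/25 * I : ℂ) ≠ -5/4 - 22/25 * I := by norm_num [Complex.ext_iff]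
  rw [Z, Finset.sum_insert h1, Finset.sum_insert h2, Finset.sum_insert h3, Finset.sum_insert h4, Finset.sum_pair h5]
  ring

/-- conjugate-pair resolvent sum (the only place `I² = −1` is used). -/
theorem pair_inv (w p q : ℂ) (h1 : w - p - q * I ≠ 0) (h2 : w - p + q * I ≠ 0) :
    (w - (p + q * I))⁻¹ + (w - (p - q * I))⁻¹ = 2 * (w - p) / ((w - p) ^ 2 + q ^ 2) := by
  have e1 : w - (p + q * I) = w - p - q * I := by ring
  have e2 : w - (p - q * I) = w - p + q * I := by ring
  rw [e1, e2, sq_add_sq_eq (w - p) q, eq_div_iff (mul_ne_zero h1 h2)]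
  field_simp
  ring

/-- off the zero set all six linear factors are non-zero. -/
theorem factors_ne (w : ℂ) (hw : F w ≠ 0) :
    w - I ≠ 0 ∧ w + I ≠ 0 ∧ w - 5/4 - 22/25 * I ≠ 0 ∧ w - 5/4 + 22/25 * I ≠ 0 ∧
      w + 5/4 - 22/25 * I ≠ 0 ∧ w + 5/4 + 22/25 * I ≠ 0 := by
  rw [F_factor] at hw
  simp only [ne_eq, mul_eq_zero, not_or] at hw
  obtain ⟨⟨⟨h1, h2⟩, h3, h4⟩, h5, h6⟩ := hw
  exact ⟨h1, h2, h3, h4, h5, h6⟩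

/-- `F′/F = Σ_{u ∈ Z} (w − u)⁻¹` off the zero set. -/
theorem logDeriv_eq (w : ℂ) (hw : F w ≠ 0) : deriv F w / F w = ∑ u ∈ Z, (w - u)⁻¹ := by
  obtain ⟨h1, h2, h3, h4, h5, h6⟩ := factors_ne w hw
  have hq1 : w ^ 2 + 1 ≠ 0 := by
    have := sq_add_sq_eq w 1; rw [one_mul, one_pow] at this; rw [this]; exact mul_ne_zero h1 h2
  have hq2 : (w - 5/4) ^ 2 + (22/25 : ℂ) ^ 2 ≠ 0 := by
    rw [sq_add_sq_eq]; exact mul_ne_zero (by rw [show w - 5/4 - 22/25 * I = w - 5/4 - 22/25 * I from rfl]; exact h3) h4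
  have hq3 : (w + 5/4) ^ 2 + (22/25 : ℂ) ^ 2 ≠ 0 := by
    rw [sq_add_sq_eq]; exact mul_ne_zero h5 h6
  -- pair form of the logarithmic derivative (pure ring identity, no `I`)
  have hpair : deriv F w / F w =
      2 * w / (w ^ 2 + 1) + 2 * (w - 5/4) / ((w - 5/4) ^ 2 + (22/25 : ℂ) ^ 2) +
        2 * (w + 5/4) / ((w + 5/4) ^ 2 + (22/25 : ℂ) ^ 2) := by
    rw [deriv_F, div_add_div _ _ hq1 hq2, div_add_div _ _ (mul_ne_zero hq1 hq2) hq3,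
      div_eq_div_iff hw (mul_ne_zero (mul_ne_zero hq1 hq2) hq3), F_factor_real]
    unfold F1
    ring
  rw [hpair, sum_Z]
  have p1 : (w - I)⁻¹ + (w - -I)⁻¹ = 2 * w / (w ^ 2 + 1) := by
    have := pair_inv w 0 1 (by simpa using h1) (by simpa using h2)
    simpa using this
  have p2 : (w - (5/4 + 22/25 * I))⁻¹ + (w - (5/4 - 22/25 * I))⁻¹ =
      2 * (w - 5/4) / ((w - 5/4) ^ 2 + (22/25 : ℂ) ^ 2) := pair_inv w (5/4) (22/25) h3 h4
  have p3 : (w - (-5/4 + 22/25 * I))⁻¹ + (w - (-5/4 - 22/25 * I))⁻¹ =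
      2 * (w + 5/4) / ((w + 5/4) ^ 2 + (22/25 : ℂ) ^ 2) := by
    have := pair_inv w (-5/4) (22/25) (by rw [show w - -5/4 - 22/25 * I = w + 5/4 - 22/25 * I by ring]; exact h5)
      (by rw [show w - -5/4 + 22/25 * I = w + 5/4 + 22/25 * I by ring]; exact h6)
    rw [this]; ring
  rw [← p1, ← p2, ← p3]; ring

/-- (16) the remainder box with η = 1/2, s = 1/2, hmax = 1, R = 40: the remainder is the sum over the FAR zeros
(`|Re u − Re w| ≥ 20`), at most six terms of norm ≤ 1/20 each. -/
theorem remainder_L1 : RemainderBox (1/2) F 0 (1/2) 1 40 := by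
  intro w _ _ hFw
  have hset := zeroSet_eq (fun u => |u.re - w.re| < 40 / 2)
  beta_reduce at hset
  rw [hset, finsum_mem_coe_finset]
  set T := Z.filter (fun u => |u.re - w.re| < 40 / 2) with hT
  have hsum : ∑ u ∈ T, ((analyticOrderAt F u).toNat : ℂ) * (w - u)⁻¹ = ∑ u ∈ T, (w - u)⁻¹ := by
    refine Finset.sum_congr rfl fun u hu => ?_
    simp [orderNat_one u (Finset.mem_filter.1 hu).1]
  have hTZ : T ⊆ Z := Finset.filter_subset _ Z
  have hsplit : ∑ u ∈ Z, (w - u)⁻¹ - ∑ u ∈ T, (w - u)⁻¹ = ∑ u ∈ Z \ T, (w - u)⁻¹ := by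
    rw [← Finset.sum_sdiff hTZ]; ring
  rw [hsum, logDeriv_eq w hFw, hsplit]
  have hcard : ((Z \ T).card : ℝ) ≤ 6 := by
    exact_mod_cast (Finset.card_le_card Finset.sdiff_subset).trans card_Z_le
  have hterm : ∀ u ∈ Z \ T, ‖(w - u)⁻¹‖ ≤ 1 / 20 := by
    intro u hu
    rw [Finset.mem_sdiff] at hu
    have hfar : ¬ |u.re - w.re| < 40 / 2 := fun hlt => hu.2 (Finset.mem_filter.2 ⟨hu.1, hlt⟩)
    rw [not_lt] at hfar
    have hre : |(w - u).re| ≤ ‖w - u‖ := abs_re_le_norm (w - u)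
    rw [sub_re, abs_sub_comm] at hre
    have h20 : (20 : ℝ) ≤ ‖w - u‖ := by linarith
    rw [norm_inv, inv_eq_one_div]
    calc 1 / ‖w - u‖ ≤ 1 / 20 := one_div_le_one_div_of_le (by norm_num) h20
      _ = 1 / 20 := rfl
  calc ‖∑ u ∈ Z \ T, (w - u)⁻¹‖ ≤ ∑ u ∈ Z \ T, ‖(w - u)⁻¹‖ := norm_sum_le _ _
    _ ≤ ∑ u ∈ Z \ T, (1 / 20 : ℝ) := Finset.sum_le_sum hterm
    _ = ((Z \ T).card : ℝ) * (1 / 20) := by rw [Finset.sum_const, nsmul_eq_mul]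
    _ ≤ 6 * (1 / 20) := by gcongr
    _ ≤ (1/2 : ℝ) / (1/2) := by norm_num

/-! ## growth of order 1 and the assembled legality -/

/-- clause (3): growth of order 1, `‖F z‖ ≤ 20·exp(6‖z‖)`. -/
theorem growth_L1 : ∃ A' B' ρ : ℝ, ρ < 2 ∧ ∀ z : ℂ, ‖F z‖ ≤ A' * Real.exp (B' * ‖z‖ ^ ρ) := by
  refine ⟨20, 6, 1, by norm_num, fun z => ?_⟩
  rw [Real.rpow_one]
  have hr : 0 ≤ ‖z‖ := norm_nonneg z
  have hF : ‖F z‖ ≤ (‖z‖ ^ 2 + 1) * (‖z‖ ^ 4 + 7881/5000 * ‖z‖ ^ 2 + 546110161/100000000) := by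
    unfold F
    rw [norm_mul]
    gcongr
    · calc ‖z ^ 2 + 1‖ ≤ ‖z ^ 2‖ + ‖(1 : ℂ)‖ := norm_add_le _ _
        _ = ‖z‖ ^ 2 + 1 := by rw [norm_pow, norm_one]
    · calc ‖z ^ 4 - (7881/5000 : ℂ) * z ^ 2 + (546110161/100000000 : ℂ)‖
          ≤ ‖z ^ 4 - (7881/5000 : ℂ) * z ^ 2‖ + ‖(546110161/100000000 : ℂ)‖ := norm_add_le _ _
        _ ≤ ‖z ^ 4‖ + ‖(7881/5000 : ℂ) * z ^ 2‖ + ‖(546110161/100000000 : ℂ)‖ := by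
            gcongr; exact norm_sub_le _ _
        _ = ‖z‖ ^ 4 + 7881/5000 * ‖z‖ ^ 2 + 546110161/100000000 := by
            rw [norm_pow, norm_mul, norm_pow]; norm_num
  have hE : Real.exp (6 * ‖z‖) = Real.exp ‖z‖ ^ 6 := by
    rw [← Real.exp_nat_mul]; norm_num
  rw [hE]
  have h1 : 1 ≤ Real.exp ‖z‖ := Real.one_le_exp hr
  have hle : ‖z‖ ≤ Real.exp ‖z‖ := by linarith [Real.add_one_le_exp ‖z‖]
  have h2 : ‖z‖ ^ 2 ≤ Real.exp ‖z‖ ^ 2 := pow_le_pow_left₀ hr hle 2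
  have h4 : ‖z‖ ^ 4 ≤ Real.exp ‖z‖ ^ 4 := pow_le_pow_left₀ hr hle 4
  have hE2 : 1 ≤ Real.exp ‖z‖ ^ 2 := one_le_pow₀ h1
  have hE4 : Real.exp ‖z‖ ^ 2 ≤ Real.exp ‖z‖ ^ 4 := by nlinarith
  have hA : ‖z‖ ^ 2 + 1 ≤ 2 * Real.exp ‖z‖ ^ 2 := by linarith
  have hB : ‖z‖ ^ 4 + 7881/5000 * ‖z‖ ^ 2 + 546110161/100000000 ≤ 9 * Real.exp ‖z‖ ^ 4 := by nlinarith
  calc ‖F z‖ ≤ (‖z‖ ^ 2 + 1) * (‖z‖ ^ 4 + 7881/5000 * ‖z‖ ^ 2 + 546110161/100000000) := hF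
    _ ≤ (2 * Real.exp ‖z‖ ^ 2) * (9 * Real.exp ‖z‖ ^ 4) := mul_le_mul hA hB (by positivity) (by positivity)
    _ = 18 * Real.exp ‖z‖ ^ 6 := by ring
    _ ≤ 20 * Real.exp ‖z‖ ^ 6 := by nlinarith [pow_pos (Real.exp_pos ‖z‖) 6]

/-- **LEGALITY of the 162 row of record, in the kernel**: the frame `F` with the tuple
`(C, η, x₀, s, hmax, R, Hs, B) = (2, 1/2, 0, 1/2, 1, 40, 1, 100)` satisfies `EngineHyps5` (Rev6, the one lens-1's laws quantify over). -/
theorem engineHyps5_L1 : EngineHyps5 2 (1/2) F 0 (1/2) 1 40 1 100 := by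
  refine ⟨differentiable_F, F_real, growth_L1, by norm_num, by norm_num, by norm_num, by norm_num, by norm_num,
    fun w hw => F_zero_im w hw, by norm_num, ⟨I, F_I, by simp, by simp, by simp⟩, column_L1, halfSlab_L1,
    by norm_num, by norm_num, remainder_L1⟩

end RhW08.Lens1LinkTolNeg20Legal

/-! ## by-name certification against the tree constants lens-1's laws quantify over -/
example : RhIdea6.G17.W07C7.Rev6.EngineHyps5 2 (1/2) RhW08.Lens1LinkTolNeg20Legal.F 0 (1/2) 1 40 1 100 :=
  RhW08.Lens1LinkTolNeg20Legal.engineHyps5_L1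

section
open RhIdea6.G17.W07C7 RhIdea6.G17.W07C7.Rev6 RhIdea6.G18.W07C8.Law421BirthS RhIdea6.G19.W07C11.Seam
/-- the ∀-frame binder shape of lens-1's laws (`∀ η f x₀ s hmax R Hs B, EngineHyps5 2 η f x₀ s hmax R Hs B → …`)
instantiates at the row: -/
example (Law : ∀ (η : ℝ) (f : ℂ → ℂ) (x₀ s hmax R Hs : ℝ) (B : ℕ), EngineHyps5 2 η f x₀ s hmax R Hs B → False) : False :=
  Law _ _ _ _ _ _ _ _ RhW08.Lens1LinkTolNeg20Legal.engineHyps5_L1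
end

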